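import Literature.NumberTheory.LFunctions.HybridCharSumLFunction
import HarnessLib

/-!
# Inverse roots of a polynomial `L`-function: `S_ν = −(ω₁^ν + ⋯ + ω_ℓ^ν)` (Schmidt, Ch. II §6, §10)

Topic `Literature/NumberTheory/LFunctions` (exponential sums), grouping namespace `HybridLFunction`.
W. M. Schmidt, *Equations over Finite Fields. An Elementary Approach*, LNM 536 (1976), Ch. II
§6 ((6.5)–(6.7): if `L(U) = 1 + c₁U + ⋯ + c_ℓ U^ℓ = Π_j (1 − ω_j U)` then
`U L'(U)/L(U) = −Σ_ν (ω₁^ν + ⋯ + ω_ℓ^ν) U^ν`) and §10 (Corollary 10D: the character sums over the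
extensions `𝔽_{q^ν}` are `S_ν = −(ω₁^ν + ⋯ + ω_ℓ^ν)`). We PROVE the purely algebraic statement
behind this, for arbitrary complex sequences:

* `exists_eq_neg_powerSum` — if `c₀ = 1`, `c_n = 0` for `n > ℓ`, and the von Mangoldt identity
  `n c_n = Σ_{i=1}^n s_i c_{n−i}` holds for all `n ≥ 1`, then there are `ω₁, …, ω_ℓ ∈ ℂ` (the
  roots of `T^ℓ + c₁T^{ℓ−1} + ⋯ + c_ℓ`, with multiplicity) such that `s_n = −Σ_j ω_j^n` for all
  `n ≥ 1` (Vieta + Newton's identities, then strong induction on `n`);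
* `exists_psumOf_eq_neg_powerSum` — the same for the coefficients `lsumOf Λ`, `psumOf Λ` of a
  completely multiplicative `Λ` on monic polynomials with `c_n = 0` for `n > ℓ`;
* `exists_hybridSum_eq_neg_sum` — for the hybrid function `lam χ ψ c r b` of
  `HybridCharSumLFunction.lean` (`χ ≠ 1`, distinct roots `r_i`, `ℓ ≥ 1`): there are
  `ω : Fin ℓ → ℂ` with `psumOf λ n = −Σ_j ω_j^n` (`n ≥ 1`) and in particular
  `Σ_{x ∈ F} χ(c Π_i (x − r_i)) ψ(bx) = −Σ_j ω_j`. [cite: Schmidt1976, Ch. II §6 (6.5)–(6.7), §10 Corollary 10D]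

## References

* W. M. Schmidt, *Equations over Finite Fields. An Elementary Approach*, Lecture Notes in
  Math. 536, Springer (1976), Ch. II §6, §10.
-/

noncomputable section

open Finset Polynomial

namespace Literature.NumberTheory.LFunctions

namespace HybridLFunction

/-! ### Reindexing Newton's identities -/

/-- `Σ_{a+b=k, a<k} g(a, b) = Σ_{i=1}^{k} g(k−i, i)`. [folklore] -/
theorem sum_antidiagonal_filter_fst_lt {M : Type*} [AddCommMonoid M] (k : ℕ) (g : ℕ × ℕ → M) :
    ∑ a ∈ (HasAntidiagonal.antidiagonal k).filter (fun a : ℕ × ℕ => a.1 < k), g a =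
      ∑ i ∈ Finset.Icc 1 k, g (k - i, i) := by
  refine Finset.sum_nbij' (fun a => a.2) (fun i => (k - i, i)) ?_ ?_ ?_ ?_ ?_
  · intro a ha
    simp only [Finset.mem_filter, Finset.HasAntidiagonal.mem_antidiagonal] at ha
    simp only [Finset.mem_Icc]
    omega
  · intro i hi
    simp only [Finset.mem_Icc] at hi
    simp only [Finset.mem_filter, Finset.HasAntidiagonal.mem_antidiagonal]
    omega
  · intro a ha
    simp only [Finset.mem_filter, Finset.HasAntidiagonal.mem_antidiagonal] at ha
    obtain ⟨a1, a2⟩ := a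
    simp only [Prod.mk.injEq, and_true]
    simp only at ha
    omega
  · intro i _
    rfl
  · intro a ha
    simp only [Finset.mem_filter, Finset.HasAntidiagonal.mem_antidiagonal] at ha
    obtain ⟨a1, a2⟩ := a
    simp only at ha ⊢
    rw [show k - a2 = a1 by omega]

/-- **Newton's identities at a point**: for `ω : σ → ℂ` with elementary symmetric functions
`E_j = e_j(ω)` and power sums `P_m = Σ_i ω_i^m`, in terms of `c_j = (−1)^j E_j`:
`k c_k = Σ_{i=1}^{k} (−P_i) c_{k−i}` for every `k` (Mathlib's `MvPolynomial.mul_esymm_eq_sum`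
evaluated at `ω`). [folklore] -/
theorem newton_eval {σ : Type*} [Fintype σ] [DecidableEq σ] (ω : σ → ℂ) (k : ℕ) :
    (k : ℂ) * ((-1) ^ k * (Finset.univ.val.map ω).esymm k) =
      ∑ i ∈ Finset.Icc 1 k, (-∑ x, ω x ^ i) *
        ((-1) ^ (k - i) * (Finset.univ.val.map ω).esymm (k - i)) := by
  have h := congrArg (MvPolynomial.aeval ω) (MvPolynomial.mul_esymm_eq_sum σ ℂ k)
  have hpsum : ∀ m, MvPolynomial.aeval ω (MvPolynomial.psum σ ℂ m) = ∑ x, ω x ^ m := by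
    intro m; simp [MvPolynomial.psum]
  simp only [map_mul, map_natCast, map_pow, map_neg, map_one, map_sum,
    MvPolynomial.aeval_esymm_eq_multiset_esymm, hpsum] at h
  set E : ℕ → ℂ := fun j => (Finset.univ.val.map ω).esymm j with hE
  have h' : (k : ℂ) * E k = (-1) ^ (k + 1) *
      ∑ a ∈ (HasAntidiagonal.antidiagonal k).filter (fun a : ℕ × ℕ => a.1 < k),
        (-1) ^ a.1 * E a.1 * ∑ x, ω x ^ a.2 := h
  calc (k : ℂ) * ((-1) ^ k * E k) = (-1) ^ k * ((k : ℂ) * E k) := by ring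
    _ = -∑ a ∈ (HasAntidiagonal.antidiagonal k).filter (fun a : ℕ × ℕ => a.1 < k),
          (-1) ^ a.1 * E a.1 * ∑ x, ω x ^ a.2 := by
        rw [h', ← mul_assoc, ← pow_add, show k + (k + 1) = 2 * k + 1 by ring, pow_succ, pow_mul]
        norm_num
    _ = ∑ a ∈ (HasAntidiagonal.antidiagonal k).filter (fun a : ℕ × ℕ => a.1 < k),
          (-∑ x, ω x ^ a.2) * ((-1) ^ a.1 * E a.1) := by
        rw [← Finset.sum_neg_distrib]
        exact Finset.sum_congr rfl fun a _ => by ring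
    _ = ∑ i ∈ Finset.Icc 1 k, (-∑ x, ω x ^ i) * ((-1) ^ (k - i) * E (k - i)) :=
        sum_antidiagonal_filter_fst_lt k _

/-! ### From the von Mangoldt identity to power sums of the inverse roots -/

/-- **Schmidt II (6.5)–(6.7) / Corollary 10D, algebraic core — PROVED.** Let `c, s : ℕ → ℂ` with
`c₀ = 1`, `c_n = 0` for `n > ℓ`, and `n c_n = Σ_{i=1}^{n} s_i c_{n−i}` for all `n ≥ 1` (i.e.
`U L' = (Σ_n s_n U^n) L` for the polynomial `L(U) = Σ_{n ≤ ℓ} c_n U^n`). Then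
`L(U) = Π_{j<ℓ} (1 − ω_j U)` for the roots `ω_j` of `T^ℓ + c₁ T^{ℓ−1} + ⋯ + c_ℓ` and
`s_n = −(ω₁^n + ⋯ + ω_ℓ^n)` for every `n ≥ 1`. [cite: Schmidt1976, Ch. II §6, (6.5)–(6.7)] -/
theorem exists_eq_neg_powerSum {c s : ℕ → ℂ} {ℓ : ℕ} (hc0 : c 0 = 1)
    (hcv : ∀ n, ℓ < n → c n = 0)
    (hrec : ∀ n : ℕ, 1 ≤ n → (n : ℂ) * c n = ∑ i ∈ Finset.Icc 1 n, s i * c (n - i)) :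
    ∃ ω : Fin ℓ → ℂ, ∀ n, 1 ≤ n → s n = -∑ i, ω i ^ n := by
  classical
  -- the reversed polynomial `R(T) = T^ℓ + c_1 T^{ℓ-1} + ⋯ + c_ℓ` and its roots
  set R : ℂ[X] := KloostermanLFunction.ofCoeffs ℓ (fun i : Fin ℓ => c (ℓ - i)) with hR
  have hRm : R.Monic := KloostermanLFunction.monic_ofCoeffs _ _
  have hRd : R.natDegree = ℓ := KloostermanLFunction.natDegree_ofCoeffs _ _
  have hsplit : R.Splits := IsAlgClosed.splits R
  have hroots : R.roots.card = ℓ := by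
    rw [← hRd]; exact Polynomial.splits_iff_card_roots.mp hsplit
  -- Vieta: `c_j = (-1)^j e_j(roots)` for every `j`
  have hvieta : ∀ j, c j = (-1) ^ j * R.roots.esymm j := by
    intro j
    rcases le_or_gt j ℓ with hj | hj
    · have h := Polynomial.coeff_eq_esymm_roots_of_card (p := R) (by rw [hroots, hRd])
        (k := ℓ - j) (by rw [hRd]; omega)
      rw [hRm.leadingCoeff, one_mul, hRd, show ℓ - (ℓ - j) = j by omega] at h
      rw [← h]
      rcases Nat.eq_zero_or_pos j with rfl | hj0
      · rw [Nat.sub_zero, hc0, ← hRd]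
        exact hRm.coeff_natDegree.symm
      · rw [hR, KloostermanLFunction.coeff_ofCoeffs_of_lt _ (show ℓ - j < ℓ by omega)]
        dsimp only
        congr 1
        omega
    · rw [hcv j hj, Multiset.esymm, Multiset.powersetCard_eq_empty _ (by rw [hroots]; exact hj)]
      simp
  -- Newton at the roots (indexed by the type of the multiset of roots)
  have hE : ∀ j, (Finset.univ.val.map fun x : R.roots => (x : ℂ)).esymm j = R.roots.esymm j := by
    intro j; rw [Multiset.map_univ_coe]
  have hnewton : ∀ k : ℕ, (k : ℂ) * c k =
      ∑ i ∈ Finset.Icc 1 k, (-∑ x : R.roots, (x : ℂ) ^ i) * c (k - i) := by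
    intro k
    have h := newton_eval (fun x : R.roots => (x : ℂ)) k
    simp only [hE] at h
    rw [hvieta k, h]
    exact Finset.sum_congr rfl fun i _ => by rw [hvieta (k - i)]
  -- strong induction: `s_n = -Σ ω^n`
  have hst : ∀ n, 1 ≤ n → s n = -∑ x : R.roots, (x : ℂ) ^ n := by
    intro n
    induction n using Nat.strong_induction_on with
    | _ n ih =>
      intro hn
      obtain ⟨m, rfl⟩ : ∃ m, n = m + 1 := ⟨n - 1, by omega⟩
      have h1 := hrec (m + 1) hn
      have h2 := hnewton (m + 1)
      rw [h1, Finset.sum_Icc_succ_top (by omega), Finset.sum_Icc_succ_top (by omega), Nat.sub_self,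
        hc0, mul_one, mul_one] at h2
      have h3 : ∑ i ∈ Finset.Icc 1 m, s i * c (m + 1 - i) =
          ∑ i ∈ Finset.Icc 1 m, (-∑ x : R.roots, (x : ℂ) ^ i) * c (m + 1 - i) := by
        refine Finset.sum_congr rfl fun i hi => ?_
        rw [Finset.mem_Icc] at hi
        rw [ih i (by omega) hi.1]
      rw [h3] at h2
      exact add_left_cancel h2
  -- transfer the index type to `Fin ℓ`
  have hcard : Fintype.card R.roots = ℓ := by rw [Multiset.card_coe, hroots]
  let e : R.roots ≃ Fin ℓ := Fintype.equivFinOfCardEq hcard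
  refine ⟨fun i => (e.symm i : ℂ), fun n hn => ?_⟩
  rw [hst n hn, ← Equiv.sum_comp e.symm (fun x : R.roots => (x : ℂ) ^ n)]

variable {F : Type*} [Field F] [Fintype F] [DecidableEq F]

/-- **Power sums of the inverse roots of `L(U) = Σ_h Λ(h) U^{deg h}`**: if `Λ` is completely
multiplicative on monic polynomials and `c_n = 0` for `n > ℓ`, then there are `ω₁, …, ω_ℓ ∈ ℂ` with
`S_n = psumOf Λ n = −(ω₁^n + ⋯ + ω_ℓ^n)` for all `n ≥ 1` (Schmidt II §6 (6.7) with Theorem 8B).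
[cite: Schmidt1976, Ch. II §6 (6.7), §8 Theorem 8B] -/
theorem exists_psumOf_eq_neg_powerSum {Λ : F[X] → ℂ} (hΛ : IsMonicMul Λ) {ℓ : ℕ}
    (hvan : ∀ n, ℓ + 1 ≤ n → lsumOf Λ n = 0) :
    ∃ ω : Fin ℓ → ℂ, ∀ n, 1 ≤ n → psumOf Λ n = -∑ i, ω i ^ n :=
  exists_eq_neg_powerSum (c := lsumOf Λ) (s := psumOf Λ) (lsumOf_zero hΛ)
    (fun n hn => hvan n hn) (fun n _ => mul_lsumOf_eq_sum hΛ n)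

/-- **The hybrid sum and its companions are power sums of `ℓ` complex numbers** (Schmidt II §9 with
Corollary 10D, for split `f`): for `χ ≠ 1`, distinct `r_i` (`i < ℓ`, `ℓ ≥ 1`) there are
`ω : Fin ℓ → ℂ` with `psumOf λ n = −Σ_j ω_j^n` for all `n ≥ 1`, and in particular
`Σ_{x ∈ F} χ(c Π_i (x − r_i)) ψ(bx) = −Σ_j ω_j`. [cite: Schmidt1976, Ch. II §9 and §10 Corollary 10D] -/
theorem exists_hybridSum_eq_neg_sum (χ : MulChar F ℂ) (ψ : AddChar F ℂ) (c : F) {ℓ : ℕ}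
    (r : Fin ℓ → F) (b : F) (hχ : χ ≠ 1) (hr : Function.Injective r) (hℓ : 1 ≤ ℓ) :
    ∃ ω : Fin ℓ → ℂ, (∀ n, 1 ≤ n → psumOf (lam χ ψ c r b) n = -∑ i, ω i ^ n) ∧
      ∑ x : F, χ (c * ∏ i, (x - r i)) * ψ (b * x) = -∑ i, ω i := by
  obtain ⟨ω, hω⟩ := exists_psumOf_eq_neg_powerSum (isMonicMul_lam χ ψ c r b)
    (fun n hn => lsumOf_lam_eq_zero r χ ψ c b hχ hr hℓ hn)
  refine ⟨ω, hω, ?_⟩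
  rw [← lsumOf_lam_one, ← psumOf_one (isMonicMul_lam χ ψ c r b), hω 1 le_rfl]
  simp

end HybridLFunction

end Literature.NumberTheory.LFunctions
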